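/-
Copyright (c) 2026. All rights reserved.
Released under Apache 2.0 license as described in the file LICENSE.
-/
import Literature.AlgebraicGeometry.Pohlmann1968.MultiquadraticCMFieldDegreeSixteenHodgeConjecture
import Literature.AlgebraicGeometry.Pohlmann1968.GaloisOcticCMFieldAllPowersHodgeConjecture
import Literature.NumberTheory.ComplexMultiplication.DegenerateCMTypesElementaryAbelianOrderSixteen
import Literature.NumberTheory.ComplexMultiplication.CMTypeEquivalenceClassesCount
import Literature.AlgebraicGeometry.Pohlmann1968.CMTypeRankInducedType
import HarnessLib

/-!
# Multiquadratic CM fields of degree `16`: NO primitive CM type is degenerate, so the Hodge conjecture holds for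
# EVERY power of EVERY abelian variety with complex multiplication by `K = ℚ(√−d, √a, √b, √c)` — unconditionally

Sequel of `MultiquadraticCMFieldDegreeSixteenHodgeConjecture` (seat p10 g37-#10: ranks `9, 5, 2`; the extreme ranks
carry the Hodge conjecture for all powers) closing its rank-`5` gap with the group-level theorem of
`NumberTheory/ComplexMultiplication/DegenerateCMTypesElementaryAbelianOrderSixteen` (g37-#11): a rank-`5` CM type on
`(ℤ/2)⁴` is stabilised by a translation `h ≠ 1`.  On the field `K` (Galois over `ℚ` with `Gal(K/ℚ)` of exponent `2`,
`[K:ℚ] = 16`): a rank-`5` CM type `Φ` satisfies `Φh = Φ` for some `1 ≠ h ∈ Gal(K/ℚ)`, hence (BCLLMNO Prop. 3.3 / Lang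
Thm. 3.6, tree `exists_inducedCMType_of_twist_eq`) is induced from a proper subfield `k`, necessarily octic
(`Rank(Ψ) = 5 ≤ [k:ℚ]/2 + 1`), over which the inducing type `Ψ` is NONDEGENERATE (`5 = 8/2 + 1`) — so Pohlmann–Hazama
(tree `IsNondegenerate.hodgeClassSpan_pow_eq_divisorClassesSpan_inducedCMType`; B. B. Gordon [Gordon1999HodgeAVSurvey]
Thm. 6.4) gives `Bᵐ(Aⁿ) ⊗ ℂ = Dᵐ(Aⁿ) ⊗ ℂ` for every realisation.  T. Kubota [Kubota1965] §4 Lemma 2; B. Dodson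
[Dodson1984] §3.1.1; K. A. Ribet [Ribet1980] §3.

* §1 **`exists_ne_one_comp_mem_iff_of_cmTypeRank_eq_five`** (`[K:ℚ] = 16`, exponent `2`, `Rank(Φ) = 5` ⟹ `Φg = Φ`
  for some `g ≠ 1`); **`not_isPrimitive_of_cmTypeRank_eq_five`**; **`isNondegenerate_of_isPrimitive_of_finrank_eq_sixteen`**
  (NO PRIMITIVE CM TYPE OF A MULTIQUADRATIC CM FIELD OF DEGREE `16` IS DEGENERATE — Ribet's question for `(ℤ/2)⁴`);
  `exists_inducedCMType_octic_of_cmTypeRank_eq_five` (rank `5` ⟹ `Φ = Ψ^K`, `Ψ` a NONDEGENERATE type of an octic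
  subfield); `isSimple_iff_isNondegenerate_of_finrank_eq_sixteen`, `isSimple_iff_cmTypeRank_eq_nine`.
* §2 **`hodgeClassSpan_pow_eq_divisorClassesSpan_of_finrank_eq_sixteen`** — for EVERY CM type and EVERY realisation
  `(A, ι, θ)`: `Bᵐ(Aⁿ) ⊗ ℂ = Dᵐ(Aⁿ) ⊗ ℂ` for all `n, m`; **`hodgeConjectureFor_pow_of_finrank_eq_sixteen`** — THE
  HODGE CONJECTURE FOR EVERY POWER OF EVERY ABELIAN VARIETY WITH COMPLEX MULTIPLICATION BY A MULTIQUADRATIC CM FIELD OF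
  DEGREE `16`, UNCONDITIONALLY; `hodgeClasses_algebraic_pow_of_finrank_eq_sixteen`,
  `not_exists_exceptional_pow_of_finrank_eq_sixteen`.

HONEST SCOPE.  Degree `16` and exponent `2` only; the rank-`5` types are exactly the types induced from a primitive
(nondegenerate) type of one of the octic CM subfields.  THEOREMS ONLY: no definition, no named fact, no instance, no
`sorry`.

## References

* [Kubota1965] T. Kubota, Trans. AMS 118 (1965), §4 Lemma 2.
* [Dodson1984] B. Dodson, Trans. AMS 283 (1984), §3.1.1 Theorem.
* [Ribet1980] K. A. Ribet, §3 (3.5), Examples (3.7).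
* [BCLLMNO2015] Bisson et al., §3 Prop. 3.3 (stabiliser ⟹ induced).
* [Lang1983ComplexMultiplication] S. Lang, *Complex Multiplication*, Ch. I Thm. 3.6.
* [Gordon1999HodgeAVSurvey] B. B. Gordon, Thm. 6.4, §9.3.
* [Shimura1998] G. Shimura, §8.2 Prop. 26.

## Provenance

Lane `lit-hodgefound` (Track 2, Layer A4/A5), seat `lit-hodgefound-p10` generation 37, row g37-#12; neighbours cited
by name, nothing restated: `DegenerateCMTypesElementaryAbelianOrderSixteen`
(`ExponentTwo.exists_ne_one_forall_mul_mem_iff_of_typeRank_eq_five`), `CMTypeEquivalenceClassesCount`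
(`exists_inducedCMType_of_twist_eq`), `CMTypeRankInducedType` (`cmTypeRank_inducedCMType`),
`MultiquadraticCMFieldDegreeSixteenHodgeConjecture` (`hodgeClassSpan_pow_eq_divisorClassesSpan_of_cmTypeRank_ne_five_of_finrank_eq_sixteen`),
`DegenerateCMTypesMultiquadraticCMFieldParity` (`cmTypeRank_mem_of_finrank_eq_sixteen`), `DegenerateCMTypesCyclicCMFieldTwoOddPrimes`
(`isCMTypeWith_galType`, `cmTypeRank_eq_typeRank_galType`), `CMTypeRankCharactersNumberField` (`embOf`, `embOf_bijective`,
`card_gal_eq_finrank`), `NonSimpleCMAbelianVarietyHazamaCriterion`, `NondegenerateCMTypeDivisorClasses`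
(`cmTypeRank_le`, `IsNondegenerate.isPrimitive`, `isNondegenerate_iff`), `GaloisOcticCMFieldAllPowersHodgeConjecture`
(`Multiquadratic.not_isPrimitive_of_comp_mem_iff`), `SimpleIffPrimitiveCMType`.
-/

open scoped BigOperators NumberField IsMulCommutative Classical
open NumberField Module CategoryTheory CategoryTheory.Limits

namespace Literature.AlgebraicGeometry.Pohlmann1968

namespace Multiquadratic

-- `open scoped`: the tree's action of `Aut(ℂ)` on `Hom(K, ℂ)` by composition is a scoped instance
open scoped Literature.NumberTheory.ComplexMultiplication
open Literature.NumberTheory.ComplexMultiplication (IsPrimitive inducedCMType typeRank mem_inducedCMType_iff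
  exists_inducedCMType_of_twist_eq isCMField_of_cmType_intermediateField)
open Literature.AlgebraicGeometry.Motives (CMType AbelianVariety)
open Literature.AlgebraicGeometry.HodgeTheory
open Literature.AlgebraicGeometry.VanGeemen1994 (hodgeClassSpan)
open Literature.Barriers.HodgeConjecture (divisorClassesSpan)
open Literature.AlgebraicGeometry.ComplexMultiplication (IsCMTypeRealisation isSimple_iff_isPrimitive)
open Literature.AlgebraicGeometry.Pohlmann1968.CyclicTwoOddPrimes (isCMTypeWith_galType cmTypeRank_eq_typeRank_galType)

variable {K : Type} [Field K] [NumberField K] [IsCMField K] [IsGalois ℚ K]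
  {A : AbelianVariety ℂ} {ι : 𝓞 K →+* End A} {θ : K →+* Module.End ℂ (complexBetti A.X 1)}

/-! ## §0 Helpers -/

section Helpers

/-- A group of exponent `2` is commutative. [folklore] -/
private theorem mul_comm_of_sq_eq_one₁₂ {G : Type*} [Group G] (hexp : ∀ g : G, g ^ 2 = 1) (a b : G) :
    a * b = b * a := by
  have hinv : ∀ x : G, x⁻¹ = x := fun x => inv_eq_of_mul_eq_one_right (by rw [← pow_two]; exact hexp x)
  calc a * b = (a * b)⁻¹ := (hinv _).symm
    _ = b⁻¹ * a⁻¹ := mul_inv_rev a b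
    _ = b * a := by rw [hinv, hinv]

omit [IsCMField K] in
/-- A Galois extension whose Galois group has exponent `2` is abelian. [folklore] -/
private theorem isAbelianGalois_of_sq_eq_one₁₂ (hexp : ∀ g : K ≃ₐ[ℚ] K, g ^ 2 = 1) : IsAbelianGalois ℚ K :=
  { is_comm.comm := mul_comm_of_sq_eq_one₁₂ hexp }

omit [IsCMField K] [IsGalois ℚ K] in
/-- `σ_{ht} = σ_t ∘ h` for `h² = 1` (`σ_g = φ₀ ∘ g⁻¹`). [folklore] -/
private theorem embOf_mul_eq_comp (hexp : ∀ g : K ≃ₐ[ℚ] K, g ^ 2 = 1) (φ₀ : K →+* ℂ) (h t : K ≃ₐ[ℚ] K) :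
    embOf φ₀ (h * t) = (embOf φ₀ t).comp (h : K →+* K) := by
  have hh : ∀ x : K, h (h x) = x := fun x => by
    have := AlgEquiv.congr_fun (show h * h = 1 by rw [← pow_two]; exact hexp h) x
    rwa [AlgEquiv.mul_apply, AlgEquiv.one_apply] at this
  refine RingHom.ext fun x => ?_
  rw [RingHom.comp_apply, embOf_apply, embOf_apply]
  congr 1
  rw [AlgEquiv.symm_apply_eq, AlgEquiv.mul_apply, AlgEquiv.apply_symm_apply]
  exact (hh x).symm

end Helpers

/-! ## §1 Degree `16`, rank `5`: a non-trivial stabiliser; no primitive type is degenerate -/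

section RankFive

/-- **`[K:ℚ] = 16`, `Gal(K/ℚ)` of exponent `2`, `Rank(Φ) = 5` ⟹ `Φg = Φ` for some `g ≠ 1` in `Gal(K/ℚ)`** (the
group-level theorem `exists_ne_one_forall_mul_mem_iff_of_typeRank_eq_five` on `S = {t : σ_t ∈ Φ}`, `σ_{gt} = σ_t ∘ g`).
[cite: Kubota1965, §4 Lemma 2] [cite: Dodson1984, §3.1.1 Theorem] -/
theorem exists_ne_one_comp_mem_iff_of_cmTypeRank_eq_five (hexp : ∀ g : K ≃ₐ[ℚ] K, g ^ 2 = 1)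
    (h16 : finrank ℚ K = 16) (Φ : CMType K) (hr : cmTypeRank Φ = 5) :
    ∃ g : K ≃ₐ[ℚ] K, g ≠ 1 ∧ ∀ φ : K →+* ℂ, φ.comp (g : K →+* K) ∈ Φ.1 ↔ φ ∈ Φ.1 := by
  haveI := isAbelianGalois_of_sq_eq_one₁₂ hexp
  obtain ⟨φ₀⟩ := (inferInstance : Nonempty (K →+* ℂ))
  have hcm := isCMTypeWith_galType (AbelianCMFieldExistence.apply_conjGal_eq φ₀) Φ
  have hr' : typeRank (K ≃ₐ[ℚ] K)
      (↑(Finset.univ.filter fun g : K ≃ₐ[ℚ] K => embOf φ₀ g ∈ Φ.1) : Set (K ≃ₐ[ℚ] K)) = 5 := by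
    rw [← cmTypeRank_eq_typeRank_galType Φ φ₀, hr]
  obtain ⟨g, hg1, -, hstab⟩ :=
    Literature.NumberTheory.ComplexMultiplication.CyclicCMType.ExponentTwo.exists_ne_one_forall_mul_mem_iff_of_typeRank_eq_five
      hexp hcm
      (by rw [card_gal_eq_finrank φ₀, h16]) hr'
  refine ⟨g, hg1, fun φ => ?_⟩
  obtain ⟨t, rfl⟩ := (embOf_bijective φ₀).2 φ
  have h1 := hstab t
  rw [Finset.mem_filter, Finset.mem_filter] at h1
  simp only [Finset.mem_univ, true_and] at h1
  rw [← embOf_mul_eq_comp hexp φ₀ g t, mul_comm g t]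
  exact h1

/-- **Rank-`5` CM types of a multiquadratic CM field of degree `16` are NOT primitive.** [cite: Kubota1965, §4 Lemma 2]
[cite: Shimura1998, §8.2 Prop. 26] [cite: Dodson1984, §3.1.1 Theorem] -/
theorem not_isPrimitive_of_cmTypeRank_eq_five (hexp : ∀ g : K ≃ₐ[ℚ] K, g ^ 2 = 1) (h16 : finrank ℚ K = 16)
    (Φ : CMType K) (φ₀ : K →+* ℂ) (hr : cmTypeRank Φ = 5) : ¬ IsPrimitive (ℂ ≃+* ℂ) Φ.1 φ₀ := by
  obtain ⟨g, hg1, hstab⟩ := exists_ne_one_comp_mem_iff_of_cmTypeRank_eq_five hexp h16 Φ hr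
  exact not_isPrimitive_of_comp_mem_iff Φ φ₀ hg1 hstab

/-- **NO PRIMITIVE CM TYPE OF A MULTIQUADRATIC CM FIELD OF DEGREE `16` IS DEGENERATE** (`Rank ∈ {9, 5, 2}`; ranks `5`
and `2` are imprimitive). [cite: Kubota1965, §4 Lemma 2] [cite: Ribet1980, §3 (3.5) and (3.7)] [cite: Dodson1984, §3.1.1 Theorem] -/
theorem isNondegenerate_of_isPrimitive_of_finrank_eq_sixteen (hexp : ∀ g : K ≃ₐ[ℚ] K, g ^ 2 = 1)
    (h16 : finrank ℚ K = 16) (Φ : CMType K) (φ₀ : K →+* ℂ) (hprim : IsPrimitive (ℂ ≃+* ℂ) Φ.1 φ₀) :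
    IsNondegenerate Φ := by
  rcases cmTypeRank_mem_of_finrank_eq_sixteen hexp h16 Φ with h9 | h5 | h2
  · rw [_root_.Literature.AlgebraicGeometry.Pohlmann1968.isNondegenerate_iff, h16, h9]
  · exact absurd hprim (not_isPrimitive_of_cmTypeRank_eq_five hexp h16 Φ φ₀ h5)
  · exact absurd hprim (not_isPrimitive_of_cmTypeRank_eq_two hexp (by omega) Φ φ₀ h2)

/-- **`[K:ℚ] = 16` multiquadratic: `A` simple ⟺ `Φ` nondegenerate ⟺ `Rank(Φ) = 9`.** [cite: Kubota1965, §2 and §4 Lemma 2]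
[cite: Shimura1998, §8.2 Prop. 26] -/
theorem isSimple_iff_isNondegenerate_of_finrank_eq_sixteen (hexp : ∀ g : K ≃ₐ[ℚ] K, g ^ 2 = 1)
    (h16 : finrank ℚ K = 16) (Φ : CMType K) (hA : IsCMTypeRealisation Φ A ι θ) :
    A.IsSimple ↔ IsNondegenerate Φ := by
  obtain ⟨φ₀⟩ : Nonempty (K →+* ℂ) := inferInstance
  rw [isSimple_iff_isPrimitive hA φ₀]
  exact ⟨isNondegenerate_of_isPrimitive_of_finrank_eq_sixteen hexp h16 Φ φ₀, fun hΦ => hΦ.isPrimitive φ₀⟩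

/-- `A` simple ⟺ `Rank(Φ) = 9`. [cite: Kubota1965, §4 Lemma 2] [cite: Shimura1998, §8.2 Prop. 26] -/
theorem isSimple_iff_cmTypeRank_eq_nine (hexp : ∀ g : K ≃ₐ[ℚ] K, g ^ 2 = 1) (h16 : finrank ℚ K = 16)
    (Φ : CMType K) (hA : IsCMTypeRealisation Φ A ι θ) : A.IsSimple ↔ cmTypeRank Φ = 9 := by
  rw [isSimple_iff_isNondegenerate_of_finrank_eq_sixteen hexp h16 Φ hA,
    _root_.Literature.AlgebraicGeometry.Pohlmann1968.isNondegenerate_iff, h16]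

omit [IsCMField K] [IsGalois ℚ K] in
/-- `g.symm = g` for `g² = 1`. [folklore] -/
private theorem symm_eq_self_of_sq (hexp : ∀ g : K ≃ₐ[ℚ] K, g ^ 2 = 1) (g : K ≃ₐ[ℚ] K) : g.symm = g := by
  rw [← AlgEquiv.aut_inv]
  exact inv_eq_of_mul_eq_one_right (by rw [← pow_two]; exact hexp g)

/-- **Rank `5` ⟹ `Φ = Ψ^K` for a NONDEGENERATE CM type `Ψ` of an OCTIC subfield `k ⊆ K`** (the stabiliser gives a
proper subfield, `5 = Rank(Ψ) ≤ [k:ℚ]/2 + 1` forces `[k:ℚ] = 8` and then `Ψ` has full rank).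
[cite: BCLLMNO2015, §3 Prop. 3.3] [cite: Lang1983ComplexMultiplication, Ch. I Thm. 3.6] [cite: Kubota1965, §4 Lemma 2] -/
theorem exists_inducedCMType_octic_of_cmTypeRank_eq_five (hexp : ∀ g : K ≃ₐ[ℚ] K, g ^ 2 = 1)
    (h16 : finrank ℚ K = 16) (Φ : CMType K) (hr : cmTypeRank Φ = 5) :
    ∃ (k : IntermediateField ℚ K) (Ψ : CMType k), finrank ℚ k = 8 ∧ inducedCMType (algebraMap k K) Ψ = Φ ∧
      ∃ _ : IsCMField k, IsNondegenerate Ψ := by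
  obtain ⟨g, hg1, hstab⟩ := exists_ne_one_comp_mem_iff_of_cmTypeRank_eq_five hexp h16 Φ hr
  have htwist : inducedCMType (g.symm : K →+* K) Φ = Φ := by
    apply Subtype.ext
    ext φ
    rw [mem_inducedCMType_iff, symm_eq_self_of_sq hexp g]
    exact hstab φ
  obtain ⟨k, Ψ, hk, hΨ⟩ := exists_inducedCMType_of_twist_eq hg1 htwist
  haveI hCM : IsCMField k := isCMField_of_cmType_intermediateField k Ψ
  have hrΨ : cmTypeRank Ψ = 5 := by rw [← cmTypeRank_inducedCMType (algebraMap k K) Ψ, hΨ, hr]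
  have hle : cmTypeRank Ψ ≤ finrank ℚ k / 2 + 1 := cmTypeRank_le Ψ
  have hmul : finrank ℚ k * finrank k K = finrank ℚ K := Module.finrank_mul_finrank ℚ k K
  have hkK : finrank k K ≠ 1 := fun h1 => hk (IntermediateField.finrank_eq_one_iff_eq_top.1 h1)
  have hkK0 : 0 < finrank k K := Module.finrank_pos
  have h8 : finrank ℚ k = 8 := by
    rw [h16] at hmul
    rw [hrΨ] at hle
    -- `finrank ℚ k ≥ 8`, `finrank ℚ k * m = 16` with `m ≥ 2`
    have hge : 8 ≤ finrank ℚ k := by omega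
    have hm2 : 2 ≤ finrank k K := by omega
    nlinarith
  refine ⟨k, Ψ, h8, hΨ, hCM, ?_⟩
  rw [_root_.Literature.AlgebraicGeometry.Pohlmann1968.isNondegenerate_iff, h8, hrΨ]

end RankFive

/-! ## §2 The Hodge conjecture for every power of every abelian variety with CM by `K` -/

section Hodge

/-- **`Bᵐ(Aⁿ) ⊗ ℂ = Dᵐ(Aⁿ) ⊗ ℂ` FOR ALL `n, m`, FOR EVERY ABELIAN VARIETY WITH COMPLEX MULTIPLICATION BY A MULTIQUADRATIC
CM FIELD OF DEGREE `16`** (ranks `9`, `2`: g37-#10; rank `5`: induced from a nondegenerate octic type, Pohlmann–Hazama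
along `Φ = Ψ^K`). [cite: Gordon1999HodgeAVSurvey, Thm. 6.4 and §9.3] [cite: Kubota1965, §4 Lemma 2] -/
theorem hodgeClassSpan_pow_eq_divisorClassesSpan_of_finrank_eq_sixteen (hexp : ∀ g : K ≃ₐ[ℚ] K, g ^ 2 = 1)
    (h16 : finrank ℚ K = 16) (Φ : CMType K) (hA : IsCMTypeRealisation Φ A ι θ) (n m : ℕ) :
    hodgeClassSpan (⨁ fun _ : Fin n => A).dim (⨁ fun _ : Fin n => A).X m =
      divisorClassesSpan (⨁ fun _ : Fin n => A).X (⨁ fun _ : Fin n => A).dim m := by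
  by_cases h5 : cmTypeRank Φ = 5
  · obtain ⟨k, Ψ, -, hΨ, hCM, hnd⟩ := exists_inducedCMType_octic_of_cmTypeRank_eq_five hexp h16 Φ h5
    haveI := hCM
    exact hnd.hodgeClassSpan_pow_eq_divisorClassesSpan_inducedCMType hΨ hA n m
  · exact hodgeClassSpan_pow_eq_divisorClassesSpan_of_cmTypeRank_ne_five_of_finrank_eq_sixteen hexp h16 Φ h5 hA n m

omit [IsCMField K] [IsGalois ℚ K] in
/-- `Bᵐ ⊗ ℂ = Dᵐ ⊗ ℂ` for all `m` on an abelian variety gives the Hodge conjecture for it (Lefschetz `(1,1)` and cup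
products, tree theorems). [cite: Gordon1999HodgeAVSurvey, §9.3] -/
private theorem hodgeConjectureFor_of_forall_hodgeClassSpan_eq₁₂ (B : AbelianVariety ℂ)
    (h : ∀ m : ℕ, hodgeClassSpan B.dim B.X m = divisorClassesSpan B.X B.dim m) : HodgeConjectureFor B.dim B.X :=
  ⟨nonempty_hodgeModel_holds (Motives.AbelianVariety.isSmoothProjective_holds (A := B)),
    fun m _ hc hmm => AbelianVariety.divisorClassesSpan_le_algebraicClasses B
      (fun b hb hb' => lefschetzOneOne_rational_holds (Motives.AbelianVariety.isSmoothProjective_holds (A := B)) b hb hb')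
      m ((h m) ▸ Submodule.subset_span ⟨hc, hmm⟩)⟩

/-- **THE HODGE CONJECTURE FOR EVERY POWER OF EVERY ABELIAN VARIETY WITH COMPLEX MULTIPLICATION BY A MULTIQUADRATIC CM
FIELD OF DEGREE `16`, UNCONDITIONALLY**: `K` a CM field Galois over `ℚ` with `Gal(K/ℚ)` of exponent `2` and
`[K:ℚ] = 16`, `Φ` ANY CM type, `(A, ι, θ)` ANY abelian variety of type `(K; Φ)` read on `H¹` (simple `8`-folds, `E⁸`,
squares of triquadratic fourfolds, …): `HodgeConjectureFor` holds for `Aⁿ = ⨁_{i<n} A`, every `n`.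
[cite: Gordon1999HodgeAVSurvey, Thm. 6.4 and §9.3] [cite: Kubota1965, §4 Lemma 2] [cite: Dodson1984, §3.1.1 Theorem] -/
theorem hodgeConjectureFor_pow_of_finrank_eq_sixteen (hexp : ∀ g : K ≃ₐ[ℚ] K, g ^ 2 = 1) (h16 : finrank ℚ K = 16)
    (Φ : CMType K) (hA : IsCMTypeRealisation Φ A ι θ) (n : ℕ) :
    HodgeConjectureFor (⨁ fun _ : Fin n => A).dim (⨁ fun _ : Fin n => A).X :=
  hodgeConjectureFor_of_forall_hodgeClassSpan_eq₁₂ _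
    (fun m => hodgeClassSpan_pow_eq_divisorClassesSpan_of_finrank_eq_sixteen hexp h16 Φ hA n m)

/-- **Every Hodge class on every power of an abelian variety with CM by a multiquadratic CM field of degree `16` is
algebraic.** [cite: Gordon1999HodgeAVSurvey, Thm. 6.4 and §9.3] -/
theorem hodgeClasses_algebraic_pow_of_finrank_eq_sixteen (hexp : ∀ g : K ≃ₐ[ℚ] K, g ^ 2 = 1)
    (h16 : finrank ℚ K = 16) (Φ : CMType K) (hA : IsCMTypeRealisation Φ A ι θ) (n m : ℕ)
    (c : complexBetti (⨁ fun _ : Fin n => A).X (2 * m)) (hcQ : IsRationalClass c)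
    (hcH : IsOfHodgeType (⨁ fun _ : Fin n => A).dim (⨁ fun _ : Fin n => A).X (2 * m) m m c) :
    c ∈ algebraicClasses (⨁ fun _ : Fin n => A).X m :=
  (hodgeConjectureFor_pow_of_finrank_eq_sixteen hexp h16 Φ hA n).2 m c hcQ hcH

/-- **No power of an abelian variety with CM by a multiquadratic CM field of degree `16` carries an exceptional Hodge
class.** [cite: Gordon1999HodgeAVSurvey, Thm. 6.4 and §9.3] -/
theorem not_exists_exceptional_pow_of_finrank_eq_sixteen (hexp : ∀ g : K ≃ₐ[ℚ] K, g ^ 2 = 1)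
    (h16 : finrank ℚ K = 16) (Φ : CMType K) (hA : IsCMTypeRealisation Φ A ι θ) (n m : ℕ) :
    ¬ ∃ c : complexBetti (⨁ fun _ : Fin n => A).X (2 * m), IsRationalClass c ∧
        IsOfHodgeType (⨁ fun _ : Fin n => A).dim (⨁ fun _ : Fin n => A).X (2 * m) m m c ∧
        c ∉ divisorClassesSpan (⨁ fun _ : Fin n => A).X (⨁ fun _ : Fin n => A).dim m := by
  rintro ⟨c, hcQ, hcH, hcD⟩
  exact hcD ((hodgeClassSpan_pow_eq_divisorClassesSpan_of_finrank_eq_sixteen hexp h16 Φ hA n m) ▸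
    Submodule.subset_span ⟨hcQ, hcH⟩)

/-- **The Hodge conjecture for a SIMPLE abelian `8`-fold with CM by a multiquadratic CM field of degree `16`** (the
spelling `A.dim`; nondegenerate type). [cite: Gordon1999HodgeAVSurvey, Thm. 6.4 and §9.3] [cite: Kubota1965, §4 Lemma 2] -/
theorem hodgeConjectureFor_of_isSimple_of_finrank_eq_sixteen (hexp : ∀ g : K ≃ₐ[ℚ] K, g ^ 2 = 1)
    (h16 : finrank ℚ K = 16) (Φ : CMType K) (hA : IsCMTypeRealisation Φ A ι θ) (hs : A.IsSimple) :
    HodgeConjectureFor A.dim A.X :=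
  ((isSimple_iff_isNondegenerate_of_finrank_eq_sixteen hexp h16 Φ hA).1 hs).hodgeConjectureFor hA

end Hodge

end Multiquadratic

end Literature.AlgebraicGeometry.Pohlmann1968
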